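import Mathlib
import HarnessLib.Audit
import Summits.PneNP.PneNP.Theorems.PstarGateCaseTLocal
import Summits.PneNP.PneNP.Theorems.PstarGateCaseTCycle

/-!
# One GATED chord, CASE T: every other chord closes a triangle or a square with the gated chord through `u`-edges (E2 (T1) assembled; prover-1 g18)

FRONTIER range-avoidance ladder, rung F-N3 (`stmt-PneNP-19007`), cell `pnp-ideate` (this seat's `HOME/pnp-ideate-prover-1/g18/E2-PLAN.md` §4);
restricted-model proof complexity — nothing here bears on `P` versus `NP`.

Assembly of `PstarGateCaseTLocal.caseT_fibre_dichotomy` (EQ branch: `κ₀ = 1` and `D e ∆ D e'` passes through `u`) with the XOR-graph lemma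
`PstarGateCaseTCycle` (a difference through one AND variable is an XOR-matching of at most two edges whose vertices are endpoints of exactly one of
`e, e'`).  Result `caseT_chord_local`: in CASE T of the one-gate configuration, with one gate of coefficient `κ₀ + x_u` and rank `≥ 4` of `Q_{D e}`,
`Q_{D e'}` on the chamber, every other chord `e'` (read transversely) EITHER is EXC-coupled to `e` on the chamber (rank-two exception, left to the
accounting) OR satisfies: the gate polarity is `κ₀ = 1`; `M := D e ∆ D e'` is non-empty, has at most two edges, all through `u`; every XOR vertex of `M`
is an endpoint of exactly one of `e, e'` and every other variable is an endpoint of both or of neither — `{e, e'} ∪ M` is a triangle or a square, so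
`e'` lives on the `K₄` spanned by `e` and the `u`-edges at its endpoints.
-/

set_option linter.dupNamespace false -- `Summit.PneNP.PneNP.…`: summit = sub-problem name (D-0017 single-conjunct layout)

open Finset Module Literature.Computability.Complexity
open scoped symmDiff
open Summit.PneNP.PneNP.Theorems.PstarTyped (Typed)
open Summit.PneNP.PneNP.Theorems.PstarSALevel (varSet bdry BoundaryExpanding SimpleOverlap)
open Summit.PneNP.PneNP.Theorems.PstarXCore (xpair xverts)
open Summit.PneNP.PneNP.Theorems.PstarCubeIdeals (IsAffineFn)
open Summit.PneNP.PneNP.Theorems.PstarProductRank (qform polar)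
open Summit.PneNP.PneNP.Theorems.PstarQuadRank (rad)
open Summit.PneNP.PneNP.Theorems.PstarPathRankFibre (coordKer)
open Summit.PneNP.PneNP.Theorems.PstarReadSumset (V2)
open Summit.PneNP.PneNP.Theorems.PstarChordBridgeTools (coef)
open Summit.PneNP.PneNP.Theorems.PstarChordBridge (BridgeData sys Solution Lift)
open Summit.PneNP.PneNP.Theorems.PstarChordBridgeFundamental (eq_of_fundamental_eq)
open Summit.PneNP.PneNP.Theorems.PstarGateBridge (GateHyp)
open Summit.PneNP.PneNP.Theorems.PstarGateCaseTLocal (caseT_fibre_dichotomy)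
open Summit.PneNP.PneNP.Theorems.PstarGateCaseTCycle (mem_xpair_xor_of_mem_xverts mem_xpair_iff_of_not_mem_xverts card_symmDiff_le_two)

namespace Summit.PneNP.PneNP.Theorems.PstarGateCaseTChords

variable {n m : ℕ}

/-- **CASE T: the other chords are local.**  See the module docstring. -/
theorem caseT_chord_local (I : LocalMap 4 n m) (hI : I.IsPure xorAndPred) (hT : Typed I) (hS : SimpleOverlap I) {B : BridgeData n m}
    (hW : B.WF I) (hL : Lift I B) {e : Fin m} (hG : GateHyp I B e) (hT3 : ¬ ∃ z, Solution I B B.J₀ z) {mv : V2}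
    (hmvT : mv = (0, 1) ∨ mv = (1, 1)) {e' : Fin m} (he' : e' ∈ B.N) (hne : e' ≠ e)
    (hP : ∀ a, ((sys I B).ρ e' a = 0 ∨ (sys I B).ρ e' a = mv) ∧ ((sys I B).ρ' e' a = 0 ∨ (sys I B).ρ' e' a = mv))
    (hread : ∀ a, (sys I B).ρ e' a ≠ 0 ∨ (sys I B).ρ' e' a ≠ 0)
    {u : Fin n} {κ₀ : ZMod 2} (hcoef : ∀ x, coef I B.C₁ B.G₁ (I.vars e 2) x = κ₀ + x u)
    (hrD : finrank (ZMod 2) (rad ((polar (B.D e) (fun j => I.vars j 2) (fun j => I.vars j 3)).restrict (coordKer ({u} : Finset (Fin n))))) + 4 ≤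
      finrank (ZMod 2) (coordKer ({u} : Finset (Fin n))))
    (hrD' : finrank (ZMod 2) (rad ((polar (B.D e') (fun j => I.vars j 2) (fun j => I.vars j 3)).restrict (coordKer ({u} : Finset (Fin n))))) + 4 ≤
      finrank (ZMod 2) (coordKer ({u} : Finset (Fin n)))) :
    (∃ ν₁ ν₂ : coordKer ({u} : Finset (Fin n)) → ZMod 2, IsAffineFn ν₁ ∧ IsAffineFn ν₂ ∧ ∃ κ : ZMod 2,
      ∀ w : coordKer ({u} : Finset (Fin n)),
        qform (B.D e ∆ B.D e') (fun j => I.vars j 2) (fun j => I.vars j 3) ((Pi.single u (κ₀ + 1) : Fin n → ZMod 2) + (w : Fin n → ZMod 2)) =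
          ν₁ w * ν₂ w + κ) ∨
    (κ₀ = 1 ∧ (B.D e ∆ B.D e').Nonempty ∧ (B.D e ∆ B.D e').card ≤ 2 ∧ (∀ j ∈ B.D e ∆ B.D e', I.vars j 2 = u ∨ I.vars j 3 = u) ∧
      (∀ w ∈ xverts I (B.D e ∆ B.D e'), (w ∈ xpair I e ∧ w ∉ xpair I e') ∨ (w ∉ xpair I e ∧ w ∈ xpair I e')) ∧
      (∀ w ∉ xverts I (B.D e ∆ B.D e'), (w ∈ xpair I e ↔ w ∈ xpair I e'))) := by
  classical
  rcases caseT_fibre_dichotomy I hI hT hS hW hL hG hT3 hmvT he' hne hP hread hcoef hrD hrD' with ⟨hk, hM⟩ | hexc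
  · right
    have he : e ∈ B.N := hG.1
    have heD : e ∉ B.D e := fun h => (mem_sdiff.1 (hW.hD e he h)).2 he
    have he'D : e' ∉ B.D e' := fun h => (mem_sdiff.1 (hW.hD e' he' h)).2 he'
    have hev := hW.hDeven e he
    have hev' := hW.hDeven e' he'
    refine ⟨hk, ?_, card_symmDiff_le_two I hI hS heD he'D hev hev' hM, hM,
      fun w hw => mem_xpair_xor_of_mem_xverts I hI hS heD he'D hev hev' hM hw,
      fun w hw => mem_xpair_iff_of_not_mem_xverts I hI hS heD he'D hev hev' hM hw⟩
    -- non-empty: else `D e = D e'` and `e = e'`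
    rw [nonempty_iff_ne_empty]
    intro h0
    have hDD : B.D e = B.D e' := Finset.symmDiff_eq_empty.1 h0
    have he'De : e' ∉ B.D e := by rw [hDD]; exact he'D
    rw [← hDD] at hev'
    exact hne (eq_of_fundamental_eq I hI hS heD he'De hev hev').symm
  · exact Or.inl hexc

end Summit.PneNP.PneNP.Theorems.PstarGateCaseTChords
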